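import Summits.NavierStokesRegularity.FluidComputer.StraddleInequality
import Summits.NavierStokesRegularity.FluidComputer.PowerComparison
import Summits.NavierStokesRegularity.FluidComputer.HomSobolev32Clock
import HarnessLib

/-!
# Fluid computer — L60: THE STRADDLE CLOCK — two rows astride `5/2` obey the SCALING-SHARP inviscid clock
# `Y_{5−δ}(t) · Y_{5+δ}(t) ≥ c_δ (T − t)^{−4}`, i.e. `‖u(t)‖_{Ḣ^{5/2−δ/2}} ‖u(t)‖_{Ḣ^{5/2+δ/2}} ≥ c_δ (T − t)^{−2}`, NO `ν`, NO energy

HONEST FRAMING (cell `pub-fluidc`, verbatim): *low prior, high value-of-information experiment on Tao's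
machine paradigm; NOT a claim that NS blows up.* Theorem side of the cell (the level dictionary); nothing here is
evidence of blow-up — necessities for EVERY maximal smooth finite-energy solution on `ℝ³`.

Robinson–Sadowski–Silva (2012, §V.A) 'cannot quite obtain the optimal rate `∼ t^{−1}` in `Ḣ^{5/2}`' and get `t^{−1+ε}`
with the viscosity; the optimal inviscid statement lives one step to the side of `Ḣ^{5/2}`: for the PAIR of rows
`Y₋ = Y_{5−δ}`, `Y₊ = Y_{5+δ}` (`Y_κ = ∑_j 2^{κj}‖Δ̇_j u‖₂²`, `0 < δ ≤ 4`) the sums `Z_λ = Y₋ + λY₊` obey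
`Z_λ' ≲ λ^{−1/4} Z_λ^{3/2}` uniformly in `λ > 0` (`StraddleInequality.straddle_two_point`: the Lipschitz row is
`≲ (Y₋Y₊)^{1/4} ≤ λ^{−1/4} Z_λ^{1/2}`), whence

* `straddle_clock_lam` — for EVERY `λ > 0`: `c λ^{1/2} (T − t)^{−2} ≤ Y₋(t) + λ Y₊(t)` at every `t ∈ (0, T)`, `c = c_δ`
  independent of `λ` (comparison `PowerComparison.rpow_mul_le_of_rpow`, `q = 1/2`);
* `straddle_clock` (**L60**) — optimising `λ` at the instant (`λ ≈ Y₋/Y₊`):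
  **`c_δ (T − t)^{−4} ≤ Y_{5−δ}(t) · Y_{5+δ}(t)`** at EVERY `t ∈ (0, T)`, with NO viscosity and NO energy in `c_δ`;
* `homSobolev_straddle_clock_sq`, `homSobolev_straddle_clock` (**L60 IN `Ḣ^s`**) —
  `c (T − t)^{−2} ≤ ‖u(t)‖_{Ḣ^{(5−δ)/2}} · ‖u(t)‖_{Ḣ^{(5+δ)/2}}`; `straddle_clock_of_cascadeWitness` — interface reading.

WHY IT MATTERS: the exponent is SCALING-SHARP (`(2s₋−1)/4 + (2s₊−1)/4 = 2` for `s₋ + s₊ = 5`) — strictly better than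
multiplying L58 (`Y_{5−δ} ≳ ν^{δ/2}(T−t)^{−(4−δ)/2}`) by L59 (`Y_{5+δ} ≳ ‖u‖₂^{−2δ/5}(T−t)^{−2(5+δ)/5}`), whose product has
exponent `4 − δ/10`; and the constant carries NEITHER `ν` NOR `‖u₀‖₂`: an absolute, Euler-strength necessity at the
Lipschitz level of the dictionary. HONEST PLACEMENT: in print the sharper `Ḃ^{5/2}_{2,1}` statement
`‖u(t)‖_{Ḃ^{5/2}_{2,1}} ≳ (T − t)^{−1}` is McCormick–Olson–Robinson–Rodrigo–Vidal-López–Zhou 2016, and it IMPLIES L60 by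
`(∑_l 2^{5l/2}a_l)⁴ ≲ Y_{5−δ}Y_{5+δ}` (`StraddleInterpolation.lipRow_pow_four_le`); the tree proves L60 DIRECTLY by the
`λ`-family (no differential inequality for the `ℓ¹` row is typed). Constants inexplicit; class = NS maximal smooth LH
solutions on `ℝ³`. 0 sorry; no definitions; no named facts.

## References

* J. C. Robinson, W. Sadowski, R. P. Silva, J. Math. Phys. 53 (2012) 115618, §V.A. [RobinsonSadowskiSilva2012]
* D. S. McCormick, E. J. Olson, J. C. Robinson, J. L. Rodrigo, A. Vidal-López, Y. Zhou, SIAM J. Math. Anal. 48 (2016)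
  2119–2132 (the `Ḃ^{5/2}_{2,1}` rate `(T−t)^{−1}`, which implies L60). [MccormickEtAl2016]
* J. T. Beale, T. Kato, A. Majda, Comm. Math. Phys. 94 (1984) 61–66 (the Lipschitz level). [BealeKatoMajda1984]
-/

noncomputable section

open MeasureTheory Set Function Filter Topology
open scoped ENNReal NNReal
open Literature.Analysis.FluidPDE Literature.Analysis.FunctionSpaces
open Literature.Analysis.FluidPDE.FluidComputer
open Summit.NavierStokesRegularity.NavierStokesRegularity.Theorems.FluidComputer (x5a_of_cascadeWitness')
open Summit.NavierStokesRegularity.FluidComputer.BlockEnergyTransport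
open Summit.NavierStokesRegularity.FluidComputer.StraddleInequality
open Summit.NavierStokesRegularity.FluidComputer.PowerComparison
open Summit.NavierStokesRegularity.FluidComputer.HomSobolev32Clock

namespace Summit.NavierStokesRegularity.FluidComputer.StraddleClock

/-! ## The clock of each sum `Y₋ + λ Y₊` -/

/-- **The straddling sums, every `λ`.** For every `δ ∈ (0, 4]` there is `c = c_δ > 0` such that for every `ν > 0`,
`T > 0`, every maximal smooth solution `(u, p)` of the unforced Navier–Stokes system on `ℝ³ × [0, T)` which is
Leray–Hopf from `u 0`, EVERY `λ > 0` and EVERY `t ∈ (0, T)`: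
`c · λ^{1/2} · (T − t)^{−2} ≤ Y_{5−δ}(t) + λ · Y_{5+δ}(t)` (real numbers; `Y_κ(t) = ∑_j 2^{κj}‖Δ̇_j u(t)‖₂²`) — the
integrated law `Z(b) − Z(t) ≤ Kλ^{−1/4}∫Z^{3/2}` (`straddle_two_point`), the comparison `rpow_mul_le_of_rpow` (`q = 1/2`)
on `Z(t + ·) + ε`, the divergence of `Y_{5+δ}` (`HighRows.exists_row_gt`). [cite: RobinsonSadowskiSilva2012, §V.A] -/
theorem straddle_clock_lam {δ : ℝ} (hδ : 0 < δ) (hδ4 : δ ≤ 4) :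
    ∃ c : ℝ, 0 < c ∧ ∀ (ν T : ℝ), 0 < ν → 0 < T →
      ∀ (u : ℝ → EuclideanSpace ℝ (Fin 3) → EuclideanSpace ℝ (Fin 3)) (p : ℝ → EuclideanSpace ℝ (Fin 3) → ℝ),
      IsMaximalSmoothSolution ν 0 u p T → IsLerayHopfOn T ν 0 (u 0) u →
      ∀ (lam : ℝ), 0 < lam → ∀ t ∈ Ioo 0 T,
        c * lam ^ (1 / 2 : ℝ) * (T - t) ^ (-(2 : ℝ)) ≤
          (∑' j : ℤ, (2 : ℝ≥0∞) ^ ((5 - δ) * (j : ℝ)) * blockL2 (u t) j ^ 2).toReal +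
            lam * (∑' j : ℤ, (2 : ℝ≥0∞) ^ ((5 + δ) * (j : ℝ)) * blockL2 (u t) j ^ 2).toReal := by
  obtain ⟨K, hK, hRic⟩ := straddle_two_point hδ hδ4
  set q : ℝ := 1 / 2 with hq
  have hq0 : 0 < q := by norm_num
  refine ⟨(q * K) ^ (-(2 : ℝ)), by positivity, fun ν T hν hT u p hmax hLH lam hlam t₀ ht₀ => ?_⟩
  set Ym : ℝ → ℝ := fun τ => (∑' j : ℤ, (2 : ℝ≥0∞) ^ ((5 - δ) * (j : ℝ)) * blockL2 (u τ) j ^ 2).toReal with hYm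
  set Yp : ℝ → ℝ := fun τ => (∑' j : ℤ, (2 : ℝ≥0∞) ^ ((5 + δ) * (j : ℝ)) * blockL2 (u τ) j ^ 2).toReal with hYp
  set Y : ℝ → ℝ := fun τ => Ym τ + lam * Yp τ with hY
  have hY0 : ∀ τ, 0 ≤ Y τ := fun τ => by simp only [hY, hYm, hYp]; positivity
  set Lr : ℝ := K * lam ^ (-(1 / 4 : ℝ)) with hLr
  have hLr0 : 0 < Lr := by positivity
  have hTt : 0 < T - t₀ := sub_pos.2 ht₀.2
  -- the key claim: for every `ε > 0`, `1 ≤ q Lr (Y t₀ + ε)^q (T - t₀)`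
  have hclaim : ∀ ε : ℝ, 0 < ε → 1 ≤ q * Lr * (Y t₀ + ε) ^ q * (T - t₀) := by
    intro ε hε
    by_contra hlt
    push Not at hlt
    set A : ℝ := Y t₀ + ε with hA
    have hA0 : 0 < A := by have := hY0 t₀; linarith
    have hAq : 0 < A ^ q := Real.rpow_pos_of_pos hA0 _
    set θ : ℝ := 1 - q * Lr * A ^ q * (T - t₀) with hθ
    have hθ0 : 0 < θ := by linarith
    obtain ⟨b, hb, hMb⟩ := HighRows.exists_row_gt (κ := 5 + δ) (by linarith) hν hT hmax hLH ht₀.2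
      (((A ^ q / θ) ^ (1 / q)) / lam)
    have hb1 : t₀ < b := (le_max_left t₀ 0).trans_lt hb.1
    have hbT : b < T := hb.2
    have hMb' : (A ^ q / θ) ^ (1 / q) < Y b := by
      have h1 : (A ^ q / θ) ^ (1 / q) < lam * Yp b := by
        rw [div_lt_iff₀ hlam] at hMb; linarith [hMb]
      have h2 : 0 ≤ Ym b := ENNReal.toReal_nonneg
      simp only [hY]; linarith
    have hYmc : ContinuousOn Ym (Icc t₀ b) := HighRows.continuousOn_row (by linarith) hν hT hmax hLH ht₀.1 hb1.le hbT
    have hYpc : ContinuousOn Yp (Icc t₀ b) := HighRows.continuousOn_row (by linarith) hν hT hmax hLH ht₀.1 hb1.le hbT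
    have hYc : ContinuousOn Y (Icc t₀ b) := hYmc.add (continuousOn_const.mul hYpc)
    set G : ℝ → ℝ := fun τ => Y (t₀ + τ) + ε with hG
    have hmaps : MapsTo (fun τ : ℝ => t₀ + τ) (Icc 0 (b - t₀)) (Icc t₀ b) := fun τ hτ =>
      ⟨by linarith [hτ.1], by linarith [hτ.2]⟩
    have hGc : ContinuousOn G (Icc 0 (b - t₀)) :=
      ((hYc.comp (continuous_const.add continuous_id).continuousOn hmaps).add continuousOn_const)
    have hG0 : ∀ τ ∈ Icc 0 (b - t₀), 0 ≤ G τ := fun τ _ => by have := hY0 (t₀ + τ); simp only [hG]; linarith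
    have hpos : 0 < G 0 := by simp only [hG, add_zero]; exact hA0
    have hGpc : ∀ b' ∈ Icc 0 (b - t₀), ContinuousOn (fun τ => G τ ^ (1 + q)) (uIcc 0 b') := fun b' hb' => by
      rw [uIcc_of_le hb'.1]
      exact (hGc.mono (Icc_subset_Icc le_rfl hb'.2)).rpow_const fun τ _ => Or.inr (by linarith)
    have hYpc' : ∀ b' ∈ Icc 0 (b - t₀), ContinuousOn (fun τ => Y (t₀ + τ) ^ (1 + q)) (uIcc 0 b') := fun b' hb' => by
      rw [uIcc_of_le hb'.1]
      exact ((hYc.comp (continuous_const.add continuous_id).continuousOn hmaps).mono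
        (Icc_subset_Icc le_rfl hb'.2)).rpow_const fun τ _ => Or.inr (by linarith)
    have hineq : ∀ b' ∈ Icc 0 (b - t₀), G b' ≤ G 0 + Lr * ∫ τ in (0 : ℝ)..b', G τ ^ (1 + q) := by
      intro b' hb'
      have h2 := hRic ν T hν hT u p hmax hLH lam hlam t₀ (t₀ + b') ht₀.1 (by linarith [hb'.1]) (by linarith [hb'.2])
      have hpw : (3 / 2 : ℝ) = 1 + q := by rw [hq]; norm_num
      rw [hpw] at h2
      have hshift : ∫ τ in t₀..(t₀ + b'), Y τ ^ (1 + q) = ∫ τ in (0 : ℝ)..b', Y (t₀ + τ) ^ (1 + q) := by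
        rw [intervalIntegral.integral_comp_add_left (fun τ => Y τ ^ (1 + q)) t₀, add_zero]
      have hmono : ∫ τ in (0 : ℝ)..b', Y (t₀ + τ) ^ (1 + q) ≤ ∫ τ in (0 : ℝ)..b', G τ ^ (1 + q) := by
        refine intervalIntegral.integral_mono_on hb'.1 (hYpc' b' hb').intervalIntegrable
          (hGpc b' hb').intervalIntegrable fun τ _ => ?_
        exact Real.rpow_le_rpow (hY0 _) (by simp only [hG]; linarith) (by linarith)
      have h3 : Y (t₀ + b') - Y t₀ ≤ Lr * ∫ τ in (0 : ℝ)..b', G τ ^ (1 + q) := by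
        calc Y (t₀ + b') - Y t₀ ≤ K * lam ^ (-(1 / 4 : ℝ)) * ∫ τ in t₀..(t₀ + b'), Y τ ^ (1 + q) := h2
          _ ≤ Lr * ∫ τ in (0 : ℝ)..b', G τ ^ (1 + q) := by
              rw [hshift, hLr]
              exact mul_le_mul_of_nonneg_left hmono hLr0.le
      simp only [hG, add_zero]
      linarith
    have hcomp := rpow_mul_le_of_rpow hLr0.le (by linarith : 0 < b - t₀) hq0 hGc hG0 hpos hineq (b - t₀)
      ⟨by linarith, le_rfl⟩
    simp only [hG, add_zero, add_sub_cancel] at hcomp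
    have hφ : θ ≤ 1 - q * Lr * (Y t₀ + ε) ^ q * (b - t₀) := by
      have : q * Lr * A ^ q * (b - t₀) ≤ q * Lr * A ^ q * (T - t₀) :=
        mul_le_mul_of_nonneg_left (by linarith) (by positivity)
      rw [hθ, hA]; linarith
    have hYbε : 0 ≤ (Y b + ε) ^ q := Real.rpow_nonneg (by linarith [hY0 b]) _
    have h4 : (Y b + ε) ^ q * θ ≤ A ^ q := by
      calc (Y b + ε) ^ q * θ ≤ (Y b + ε) ^ q * (1 - q * Lr * (Y t₀ + ε) ^ q * (b - t₀)) :=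
            mul_le_mul_of_nonneg_left hφ hYbε
        _ ≤ (Y t₀ + ε) ^ q := hcomp
        _ = A ^ q := rfl
    have h5 : (Y b + ε) ^ q ≤ A ^ q / θ := (le_div_iff₀ hθ0).2 h4
    have h6 : Y b + ε ≤ (A ^ q / θ) ^ (1 / q) := by
      have h := Real.rpow_le_rpow hYbε h5 (by positivity : (0 : ℝ) ≤ 1 / q)
      rwa [← Real.rpow_mul (by linarith [hY0 b]), mul_one_div_cancel hq0.ne', Real.rpow_one] at h
    linarith
  -- let `ε → 0`
  have hmain : 1 ≤ q * Lr * Y t₀ ^ q * (T - t₀) := by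
    by_contra hlt
    push Not at hlt
    have hcont : ContinuousAt (fun ε : ℝ => q * Lr * (Y t₀ + ε) ^ q * (T - t₀)) 0 := by
      have h1 : ContinuousAt (fun ε : ℝ => (Y t₀ + ε) ^ q) 0 :=
        ((continuous_const.add continuous_id).continuousAt).rpow_const (Or.inr hq0.le)
      exact (continuousAt_const.mul h1).mul continuousAt_const
    have hev : ∀ᶠ ε in 𝓝[>] (0 : ℝ), q * Lr * (Y t₀ + ε) ^ q * (T - t₀) < 1 := by
      have h := (tendsto_order.1 hcont.tendsto).2 1 (by simpa using hlt)
      exact h.filter_mono nhdsWithin_le_nhds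
    obtain ⟨ε, hε, hεpos⟩ := (hev.and self_mem_nhdsWithin).exists
    exact absurd (hclaim ε hεpos) (not_le.2 hε)
  -- conclude: `Y t₀ ≥ (q Lr (T - t₀))^{-2} = (qK)^{-2} λ^{1/2} (T - t₀)^{-2}`
  have hYq : (q * Lr * (T - t₀))⁻¹ ≤ Y t₀ ^ q := by
    rw [inv_le_iff_one_le_mul₀ (by positivity)]
    calc (1 : ℝ) ≤ q * Lr * Y t₀ ^ q * (T - t₀) := hmain
      _ = Y t₀ ^ q * (q * Lr * (T - t₀)) := by ring
  have hYt : ((q * Lr * (T - t₀))⁻¹) ^ (2 : ℝ) ≤ Y t₀ := by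
    have h := Real.rpow_le_rpow (by positivity) hYq (by norm_num : (0 : ℝ) ≤ 2)
    rwa [← Real.rpow_mul (hY0 t₀), show q * 2 = 1 by rw [hq]; norm_num, Real.rpow_one] at h
  refine le_trans (le_of_eq ?_) hYt
  rw [Real.inv_rpow (by positivity), ← Real.rpow_neg (by positivity), hLr,
    show q * (K * lam ^ (-(1 / 4 : ℝ))) * (T - t₀) = (q * K) * lam ^ (-(1 / 4 : ℝ)) * (T - t₀) by ring,
    Real.mul_rpow (by positivity) hTt.le, Real.mul_rpow (by positivity) (Real.rpow_nonneg hlam.le _),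
    ← Real.rpow_mul hlam.le]
  norm_num

/-! ## L60: the straddle clock -/

/-- **L60 — THE STRADDLE CLOCK (scaling-sharp, viscosity-free, energy-free).** For every `δ ∈ (0, 4]` there is
`c = c_δ > 0` such that for every `ν > 0`, `T > 0`, every maximal smooth solution `(u, p)` of the unforced
Navier–Stokes system on `ℝ³ × [0, T)` which is Leray–Hopf from `u 0`, and EVERY `t ∈ (0, T)`:
`c · (T − t)^{−4} ≤ (∑_j 2^{(5−δ)j} ‖Δ̇_j u(t)‖₂²) · (∑_j 2^{(5+δ)j} ‖Δ̇_j u(t)‖₂²)`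
— the geometric mean of the two `Ḃ^{κ/2}_{2,2}` rows astride `κ = 5` blows up at least like `(T − t)^{−2}`, the SCALING
rate of the Lipschitz level, with an ABSOLUTE constant (no `ν`, no energy). From `straddle_clock_lam` with
`λ = (Y₋ + ε)/(Y₊ + ε)`, `ε → 0`. In print this follows from the `Ḃ^{5/2}_{2,1}` rate of McCormick et al. (2016) and
`(∑2^{5l/2}a_l)⁴ ≲ Y₋Y₊`; here it is proved directly. [cite: MccormickEtAl2016, Thm. 1.1] [cite: RobinsonSadowskiSilva2012, §V.A]
[cite: BealeKatoMajda1984, Thm. 1] -/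
theorem straddle_clock {δ : ℝ} (hδ : 0 < δ) (hδ4 : δ ≤ 4) :
    ∃ c : ℝ, 0 < c ∧ ∀ (ν T : ℝ), 0 < ν → 0 < T →
      ∀ (u : ℝ → EuclideanSpace ℝ (Fin 3) → EuclideanSpace ℝ (Fin 3)) (p : ℝ → EuclideanSpace ℝ (Fin 3) → ℝ),
      IsMaximalSmoothSolution ν 0 u p T → IsLerayHopfOn T ν 0 (u 0) u →
      ∀ t ∈ Ioo 0 T,
        ENNReal.ofReal (c * (T - t) ^ (-(4 : ℝ))) ≤
          (∑' j : ℤ, (2 : ℝ≥0∞) ^ ((5 - δ) * (j : ℝ)) * blockL2 (u t) j ^ 2) *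
            ∑' j : ℤ, (2 : ℝ≥0∞) ^ ((5 + δ) * (j : ℝ)) * blockL2 (u t) j ^ 2 := by
  obtain ⟨c₀, hc₀, H⟩ := straddle_clock_lam hδ hδ4
  refine ⟨c₀ ^ 2 / 4, by positivity, fun ν T hν hT u p hmax hLH t ht => ?_⟩
  set Yme : ℝ≥0∞ := ∑' j : ℤ, (2 : ℝ≥0∞) ^ ((5 - δ) * (j : ℝ)) * blockL2 (u t) j ^ 2 with hYme
  set Ype : ℝ≥0∞ := ∑' j : ℤ, (2 : ℝ≥0∞) ^ ((5 + δ) * (j : ℝ)) * blockL2 (u t) j ^ 2 with hYpe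
  have hYmtop : Yme ≠ ∞ := HighRows.row_ne_top (by linarith) hν hT hmax hLH ht
  have hYptop : Ype ≠ ∞ := HighRows.row_ne_top (by linarith) hν hT hmax hLH ht
  set a : ℝ := Yme.toReal with ha
  set b : ℝ := Ype.toReal with hb
  have ha0 : 0 ≤ a := ENNReal.toReal_nonneg
  have hb0 : 0 ≤ b := ENNReal.toReal_nonneg
  have hTt : 0 < T - t := sub_pos.2 ht.2
  set X : ℝ := (T - t) ^ (-(2 : ℝ)) with hX
  have hX0 : 0 < X := Real.rpow_pos_of_pos hTt _
  have hX2 : (T - t) ^ (-(4 : ℝ)) = X ^ 2 := by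
    rw [hX, ← Real.rpow_natCast, ← Real.rpow_mul hTt.le]; norm_num
  -- for every `ε > 0`: `c₀² X² ≤ 4 (a + ε)(b + ε)`
  have hε : ∀ ε : ℝ, 0 < ε → c₀ ^ 2 * X ^ 2 ≤ 4 * ((a + ε) * (b + ε)) := by
    intro ε hε
    have haε : 0 < a + ε := by linarith
    have hbε : 0 < b + ε := by linarith
    set lam : ℝ := (a + ε) / (b + ε) with hlam
    have hlam0 : 0 < lam := div_pos haε hbε
    have h1 := H ν T hν hT u p hmax hLH lam hlam0 t ht
    -- `a + λ b ≤ 2 (a + ε)`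
    have h2 : a + lam * b ≤ 2 * (a + ε) := by
      have : lam * b ≤ lam * (b + ε) := mul_le_mul_of_nonneg_left (by linarith) hlam0.le
      have e : lam * (b + ε) = a + ε := by rw [hlam]; field_simp
      linarith
    have h3 : c₀ * lam ^ (1 / 2 : ℝ) * X ≤ 2 * (a + ε) := h1.trans h2
    -- square
    have h4 : (c₀ * lam ^ (1 / 2 : ℝ) * X) ^ 2 ≤ (2 * (a + ε)) ^ 2 := pow_le_pow_left₀ (by positivity) h3 2
    have hl2 : (lam ^ (1 / 2 : ℝ)) ^ 2 = lam := by
      rw [← Real.rpow_natCast, ← Real.rpow_mul hlam0.le]; norm_num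
    have h5 : c₀ ^ 2 * lam * X ^ 2 ≤ 4 * (a + ε) ^ 2 := by
      have e : (c₀ * lam ^ (1 / 2 : ℝ) * X) ^ 2 = c₀ ^ 2 * (lam ^ (1 / 2 : ℝ)) ^ 2 * X ^ 2 := by ring
      rw [e, hl2] at h4
      linarith
    -- multiply by `(b + ε)/(a + ε)`
    rw [hlam] at h5
    have h6 : c₀ ^ 2 * ((a + ε) / (b + ε)) * X ^ 2 * (b + ε) ≤ 4 * (a + ε) ^ 2 * (b + ε) :=
      mul_le_mul_of_nonneg_right h5 hbε.le
    have e2 : c₀ ^ 2 * ((a + ε) / (b + ε)) * X ^ 2 * (b + ε) = (a + ε) * (c₀ ^ 2 * X ^ 2) := by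
      field_simp
    rw [e2, show 4 * (a + ε) ^ 2 * (b + ε) = (a + ε) * (4 * ((a + ε) * (b + ε))) by ring] at h6
    exact le_of_mul_le_mul_left h6 haε
  -- let `ε → 0`
  have hmain : c₀ ^ 2 * X ^ 2 ≤ 4 * (a * b) := by
    by_contra hlt
    push Not at hlt
    have hcont : ContinuousAt (fun ε : ℝ => 4 * ((a + ε) * (b + ε))) 0 :=
      (continuousAt_const.mul (((continuous_const.add continuous_id).mul
        (continuous_const.add continuous_id)).continuousAt))
    have hev : ∀ᶠ ε in 𝓝[>] (0 : ℝ), 4 * ((a + ε) * (b + ε)) < c₀ ^ 2 * X ^ 2 := by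
      have h := (tendsto_order.1 hcont.tendsto).2 (c₀ ^ 2 * X ^ 2) (by simpa using hlt)
      exact h.filter_mono nhdsWithin_le_nhds
    obtain ⟨ε, hε', hεpos⟩ := (hev.and self_mem_nhdsWithin).exists
    exact absurd (hε ε hεpos) (not_le.2 hε')
  have hreal : c₀ ^ 2 / 4 * (T - t) ^ (-(4 : ℝ)) ≤ a * b := by rw [hX2]; linarith
  calc ENNReal.ofReal (c₀ ^ 2 / 4 * (T - t) ^ (-(4 : ℝ))) ≤ ENNReal.ofReal (a * b) := ENNReal.ofReal_le_ofReal hreal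
    _ = ENNReal.ofReal a * ENNReal.ofReal b := ENNReal.ofReal_mul ha0
    _ = Yme * Ype := by rw [ha, hb, ENNReal.ofReal_toReal hYmtop, ENNReal.ofReal_toReal hYptop]

/-! ## L60 in the `Ḣ^s` currency -/

/-- **L60 IN `Ḣ^s`, squared form.** For every `δ ∈ (0, 4]` there is `c > 0` such that along every maximal smooth
Leray–Hopf solution of the unforced system (`ν > 0`), at EVERY `t ∈ (0, T)`:
`c (T − t)^{−4} ≤ ‖u(t)‖²_{Ḣ^{(5−δ)/2}} · ‖u(t)‖²_{Ḣ^{(5+δ)/2}}` (`straddle_clock` read through `∑_j 4^{sj}a_j² ≤ 8·4^s‖u‖²_{Ḣ^s}`,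
`HomSobolev32Clock.tsum_weight_blockL2_sq_le`). [cite: RobinsonSadowskiSilva2012, §V.A] -/
theorem homSobolev_straddle_clock_sq {δ : ℝ} (hδ : 0 < δ) (hδ4 : δ ≤ 4) :
    ∃ c : ℝ, 0 < c ∧ ∀ (ν T : ℝ), 0 < ν → 0 < T →
      ∀ (u : ℝ → EuclideanSpace ℝ (Fin 3) → EuclideanSpace ℝ (Fin 3)) (p : ℝ → EuclideanSpace ℝ (Fin 3) → ℝ),
      IsMaximalSmoothSolution ν 0 u p T → IsLerayHopfOn T ν 0 (u 0) u →
      ∀ t ∈ Ioo 0 T,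
        ENNReal.ofReal (c * (T - t) ^ (-(4 : ℝ))) ≤
          Function.eHomSobolevSeminorm ((5 - δ) / 2) (⇑EuclideanSpace.complexify ∘ u t) ^ 2 *
            Function.eHomSobolevSeminorm ((5 + δ) / 2) (⇑EuclideanSpace.complexify ∘ u t) ^ 2 := by
  obtain ⟨c, hc, H⟩ := straddle_clock hδ hδ4
  set Mm : ℝ := 8 * (2 : ℝ) ^ (5 - δ) with hMm
  set Mp : ℝ := 8 * (2 : ℝ) ^ (5 + δ) with hMp
  have hMm0 : 0 < Mm := by positivity
  have hMp0 : 0 < Mp := by positivity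
  have hMme : (8 : ℝ≥0∞) * (2 : ℝ≥0∞) ^ |2 * ((5 - δ) / 2)| = ENNReal.ofReal Mm := by
    rw [show 2 * ((5 - δ) / 2) = 5 - δ by ring, abs_of_pos (by linarith), hMm, ENNReal.ofReal_mul (by norm_num),
      ← ENNReal.ofReal_rpow_of_pos two_pos, ENNReal.ofReal_ofNat, ENNReal.ofReal_ofNat]
  have hMpe : (8 : ℝ≥0∞) * (2 : ℝ≥0∞) ^ |2 * ((5 + δ) / 2)| = ENNReal.ofReal Mp := by
    rw [show 2 * ((5 + δ) / 2) = 5 + δ by ring, abs_of_pos (by linarith), hMp, ENNReal.ofReal_mul (by norm_num),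
      ← ENNReal.ofReal_rpow_of_pos two_pos, ENNReal.ofReal_ofNat, ENNReal.ofReal_ofNat]
  refine ⟨c / (Mm * Mp), by positivity, fun ν T hν hT u p hmax hLH t ht => ?_⟩
  have hTt : 0 < T - t := sub_pos.2 ht.2
  have hut : MemLp (u t) 2 volume := hLH.memLp t ⟨ht.1.le, ht.2.le⟩
  have h1 := H ν T hν hT u p hmax hLH t ht
  have hm := tsum_weight_blockL2_sq_le ((5 - δ) / 2) hut
  have hp := tsum_weight_blockL2_sq_le ((5 + δ) / 2) hut
  rw [hMme, show 2 * ((5 - δ) / 2) = 5 - δ by ring] at hm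
  rw [hMpe, show 2 * ((5 + δ) / 2) = 5 + δ by ring] at hp
  set Nm : ℝ≥0∞ := Function.eHomSobolevSeminorm ((5 - δ) / 2) (⇑EuclideanSpace.complexify ∘ u t) ^ 2 with hNm
  set Np : ℝ≥0∞ := Function.eHomSobolevSeminorm ((5 + δ) / 2) (⇑EuclideanSpace.complexify ∘ u t) ^ 2 with hNp
  have h3 : ENNReal.ofReal (c * (T - t) ^ (-(4 : ℝ))) ≤ (ENNReal.ofReal Mm * Nm) * (ENNReal.ofReal Mp * Np) :=
    h1.trans (mul_le_mul' hm hp)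
  have hMMne : ENNReal.ofReal (Mm * Mp) ≠ 0 := by
    rw [ne_eq, ENNReal.ofReal_eq_zero, not_le]; positivity
  have e : c / (Mm * Mp) * (T - t) ^ (-(4 : ℝ)) = (Mm * Mp)⁻¹ * (c * (T - t) ^ (-(4 : ℝ))) := by field_simp
  rw [e, ENNReal.ofReal_mul (by positivity), ENNReal.ofReal_inv_of_pos (by positivity)]
  calc (ENNReal.ofReal (Mm * Mp))⁻¹ * ENNReal.ofReal (c * (T - t) ^ (-(4 : ℝ)))
      ≤ (ENNReal.ofReal (Mm * Mp))⁻¹ * ((ENNReal.ofReal Mm * Nm) * (ENNReal.ofReal Mp * Np)) := mul_le_mul' le_rfl h3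
    _ = (ENNReal.ofReal (Mm * Mp))⁻¹ * ENNReal.ofReal (Mm * Mp) * (Nm * Np) := by
        rw [ENNReal.ofReal_mul hMm0.le]; ring
    _ = Nm * Np := by rw [ENNReal.inv_mul_cancel hMMne ENNReal.ofReal_ne_top, one_mul]

/-- **L60 — THE STRADDLE CLOCK IN `Ḣ^s`: for every `δ ∈ (0, 4]` there is `c = c_δ > 0` such that for every `ν > 0`,
`T > 0`, every maximal smooth solution `(u, p)` of the unforced Navier–Stokes system on `ℝ³ × [0, T)` which is
Leray–Hopf from `u 0`, and EVERY `t ∈ (0, T)`: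
`c · (T − t)^{−2} ≤ ‖u(t)‖_{Ḣ^{(5−δ)/2}} · ‖u(t)‖_{Ḣ^{(5+δ)/2}}`** — the product of two Sobolev norms astride `5/2` carries the
SCALING-SHARP exponent `2 = (2s₋−1)/4 + (2s₊−1)/4` with a constant free of `ν` and of the energy (RSS 2012 §V.A reach
`(T−t)^{−1+ε}` for `Ḣ^{5/2}` itself using the viscosity; McCormick et al. 2016's `Ḃ^{5/2}_{2,1}` rate `(T−t)^{−1}` implies
this product form). Necessity only; constants inexplicit. [cite: MccormickEtAl2016, Thm. 1.1]
[cite: RobinsonSadowskiSilva2012, §V.A] [cite: BealeKatoMajda1984, Thm. 1] -/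
theorem homSobolev_straddle_clock {δ : ℝ} (hδ : 0 < δ) (hδ4 : δ ≤ 4) :
    ∃ c : ℝ, 0 < c ∧ ∀ (ν T : ℝ), 0 < ν → 0 < T →
      ∀ (u : ℝ → EuclideanSpace ℝ (Fin 3) → EuclideanSpace ℝ (Fin 3)) (p : ℝ → EuclideanSpace ℝ (Fin 3) → ℝ),
      IsMaximalSmoothSolution ν 0 u p T → IsLerayHopfOn T ν 0 (u 0) u →
      ∀ t ∈ Ioo 0 T,
        ENNReal.ofReal (c * (T - t) ^ (-(2 : ℝ))) ≤
          Function.eHomSobolevSeminorm ((5 - δ) / 2) (⇑EuclideanSpace.complexify ∘ u t) *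
            Function.eHomSobolevSeminorm ((5 + δ) / 2) (⇑EuclideanSpace.complexify ∘ u t) := by
  obtain ⟨c, hc, H⟩ := homSobolev_straddle_clock_sq hδ hδ4
  refine ⟨c ^ (1 / 2 : ℝ), by positivity, fun ν T hν hT u p hmax hLH t ht => ?_⟩
  have hTt : 0 < T - t := sub_pos.2 ht.2
  have h := H ν T hν hT u p hmax hLH t ht
  have hA : 0 ≤ c * (T - t) ^ (-(4 : ℝ)) := by positivity
  have h' := ENNReal.rpow_le_rpow h (by norm_num : (0 : ℝ) ≤ 1 / 2)
  set Nm : ℝ≥0∞ := Function.eHomSobolevSeminorm ((5 - δ) / 2) (⇑EuclideanSpace.complexify ∘ u t) with hNm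
  set Np : ℝ≥0∞ := Function.eHomSobolevSeminorm ((5 + δ) / 2) (⇑EuclideanSpace.complexify ∘ u t) with hNp
  have hX : (Nm ^ 2 * Np ^ 2) ^ (1 / 2 : ℝ) = Nm * Np := by
    rw [ENNReal.mul_rpow_of_nonneg _ _ (by norm_num : (0 : ℝ) ≤ 1 / 2), ← ENNReal.rpow_natCast,
      ← ENNReal.rpow_natCast Np, ← ENNReal.rpow_mul, ← ENNReal.rpow_mul]
    norm_num
  rw [hX, ENNReal.ofReal_rpow_of_nonneg hA (by norm_num)] at h'
  refine le_trans (le_of_eq ?_) h'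
  congr 1
  rw [Real.mul_rpow hc.le (Real.rpow_nonneg hTt.le _), ← Real.rpow_mul hTt.le]
  norm_num

/-- **L60 READ ON THE INTERFACE: every cascade witness satisfies the straddle clock.** Every `W : CascadeWitness`
yields `ν > 0`, `T > 0` and a maximal smooth solution `(u, p)` of the unforced Navier–Stokes system on `ℝ³ × [0, T)`,
Leray–Hopf from `u 0` (`x5a_of_cascadeWitness'`), such that for every `δ ∈ (0, 4]`, with the constant `c_δ` of
`homSobolev_straddle_clock`: `c_δ (T − t)^{−2} ≤ ‖u(t)‖_{Ḣ^{(5−δ)/2}} ‖u(t)‖_{Ḣ^{(5+δ)/2}}` at every `t ∈ (0, T)` — whatever the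
witness's viscosity or energy. [cite: RobinsonSadowskiSilva2012, §V.A] -/
theorem straddle_clock_of_cascadeWitness (W : CascadeWitness) :
    ∃ ν : ℝ, 0 < ν ∧ ∃ T : ℝ, 0 < T ∧
      ∃ (u : ℝ → EuclideanSpace ℝ (Fin 3) → EuclideanSpace ℝ (Fin 3)) (p : ℝ → EuclideanSpace ℝ (Fin 3) → ℝ),
        IsMaximalSmoothSolution ν 0 u p T ∧ IsLerayHopfOn T ν 0 (u 0) u ∧
        ∀ δ : ℝ, ∀ hδ : 0 < δ, ∀ hδ4 : δ ≤ 4, ∀ t ∈ Ioo 0 T,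
          ENNReal.ofReal ((homSobolev_straddle_clock hδ hδ4).choose * (T - t) ^ (-(2 : ℝ))) ≤
            Function.eHomSobolevSeminorm ((5 - δ) / 2) (⇑EuclideanSpace.complexify ∘ u t) *
              Function.eHomSobolevSeminorm ((5 + δ) / 2) (⇑EuclideanSpace.complexify ∘ u t) := by
  obtain ⟨ν, hν, T, hT, u, p, hmax, hLH, -⟩ := x5a_of_cascadeWitness' W
  exact ⟨ν, hν, T, hT, u, p, hmax, hLH, fun δ hδ hδ4 t ht =>
    (homSobolev_straddle_clock hδ hδ4).choose_spec.2 ν T hν hT u p hmax hLH t ht⟩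

end Summit.NavierStokesRegularity.FluidComputer.StraddleClock

end
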